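import Literature.AlgebraicGeometry.HodgeTheory.WeilClassesBlochSeed
import Literature.AlgebraicGeometry.HodgeTheory.WeilClassesMoonenZarhinCriterion
import Literature.AlgebraicGeometry.Motives.AbelianVarietyImage
import Literature.AlgebraicGeometry.Motives.Jacobian

/-!
# Schoen's curve-built cycles on the CM Prym eightfold `B₁ = X₄₈^{new}(1,5,42)` (PREDICATES)

The frame of Schoen's 1988 construction of algebraic Weil classes on a `ℚ(√-3)`-Weil fourfold, one dimension up:
* `CM48Datum C 𝒥 σ s f` — `C` smooth projective of genus 21 with an automorphism `σ` of order 48, `s = Jac(σ)`,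
  `f = Φ₄₈(s)`-type idempotent numerator cutting the NEW part `B₁ = image f` (an abelian 8-fold with CM by `ℚ(ζ₄₈)`);
  `CMTypeIsPhi5 𝒥 s` — the CM type is the primitive type `Φ₅` (the exponent class `y⁴⁸ = x(x-1)⁵`);
* `hK ψ₀ e a` — the `√-3`-polarisation class `3·e^*a + ψ₀^*(e^*a)` attached to a projective embedding `e` of `B₁` and a
  degree-2 class `a` on the ambient projective space;
* `OrdPow C n`, `OrdPow.sumMap` — ordered powers `C^n` with their Abel sum maps to an abelian variety;
* `IsNormBuilt C 𝒥 σ f Z κ` — `Z → B₁` factors through an Abel-sum/norm map from a power of `C` composed with the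
  projection to the new part (Schoen's `F_c = Nm(C^{(4)})`-type fourfolds, their translates and components);
* `SchoenCycleAt C 𝒥 σ f ψ₀ e a Z κ` — `κ : Z → B₁` is a closed immersion of an INTEGRAL scheme of codimension exactly 4,
  norm-built, whose support carries a class `q·h_K⁴ + w` with `w` a rational `√-3`-Weil class, `w ≠ 0`.

References: [cite: Schoen1988HodgeWeil, §2 (the curve `y⁴⁸ = …`, the Prym), §3 (the cycles `F_c`, Thm. 3.1)]
[cite: vanGeemen1994HodgeAV, §5 (Weil classes)] [cite: MoonenZarhin1999LowDim, §§6–8 (Weil classes, exceptional Hodge classes)].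

Provenance: cell `hodge-schoen` round 3 «(R) RIGIDITY» (director-hodge 2026-08-25T19:27:28Z); memos of record
`run/shared/lean/pub/hodge-schoen/memos/ROUND-3-RIGIDITY.md` (85fcfe7848962e66), `ROUND-3-Rigidity.lean` (b3cbc3497475185a, plan g5),
`ROUND-3-RigidityDichotomy.lean` (fd65c70677d60b95, plan g6), `ROUND-3-ADDENDUM-g6.md`; referee audit REFEREE-REPORT.md §J (r1–r5 PASS).
Supports item `stmt-HodgeConjecture-18882` (`EightfoldBlochSeeds.BlochSeedDiscThree := HasHyperbolicBlochSeed 4 3`).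
-/

noncomputable section
open CategoryTheory CategoryTheory.Limits AlgebraicGeometry MonoidalCategory Polynomial
open Literature.AlgebraicGeometry Literature.AlgebraicGeometry.Motives
open Literature.AlgebraicGeometry.Deformation
open Literature.AlgebraicGeometry.HodgeTheory
open Literature.AlgebraicTopology.SingularHomology

namespace Literature.AlgebraicGeometry.HodgeTheory

section SchoenFrame
open scoped MonObj

/-- **CM-48 datum** (PREDICATE, record only; verbatim `HodgeSchoenPlan.R2.CM48Datum`): `C` smooth projective of
genus `21` with `σ` of order `48` whose points with non-trivial stabiliser are two points of full stabiliser and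
six points of stabiliser `⟨σ⁶⟩`; `s = σ_*`; `f = s³² + s²⁴ − s⁸ − 1` (image = the `σ⁸`-primitive Prym `B₁`, an
abelian eightfold). Satisfied by exactly the three classes `y⁴⁸ = x(x−1)^a`, `a ∈ {5, 17, 41}`; the statements
of this file add the pin `CMTypeIsPhi5` (n9) selecting `a = 5`, Schoen's `X₄₈^{new}(1,5,42)`.
[cite: Schoen1988HodgeWeil, Thm 2.0, Cor 3.1] -/
def CM48Datum (C : SchemeOver ℂ) (𝒥 : Jacobian C) (σ : C ⟶ C) (s f : 𝒥.J ⟶ 𝒥.J) : Prop :=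
  IsSmoothProjective 1 C ∧ 𝒥.J.dim = 21 ∧ End.of σ ^ 48 = 1 ∧
  (∃ S₂ S₆ : Finset (ComplexPoints C), S₂.card = 2 ∧ S₆.card = 6 ∧ Disjoint S₂ S₆ ∧
      ∀ k : ℕ, 0 < k → k < 48 → ∀ P : ComplexPoints C,
        P ≫ (End.of σ ^ k).asHom = P ↔ (P ∈ S₂ ∨ (P ∈ S₆ ∧ 6 ∣ k))) ∧
  s = 𝒥.pushforward 𝒥 σ ∧
  f = (Polynomial.eval₂ (Int.castRingHom (End 𝒥.J)) (End.of s) (X ^ 32 + X ^ 24 - X ^ 8 - 1 : Polynomial ℤ)).asHom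

/-- **`h_K = 3·e^*a + ψ₀^*e^*a`** — verbatim the polarisation class of `HasHyperbolicBlochSeed N 3`
(`= E_B` at `B₁`, census R2). [cite: vanGeemen1994HodgeAV, 5.2] -/
abbrev hK {P : AbelianVariety ℂ} (ψ₀ : P ⟶ P) (e : ProjectiveEmbedding P.X)
    (a : complexBetti (projectiveSpace e.n ℂ) 2) : complexBetti P.X 2 :=
  ((3 : ℕ) : ℂ) • complexBetti.map e.ι 2 a + complexBetti.map ψ₀.hom.hom.hom 2 (complexBetti.map e.ι 2 a)

/-- **n9 PIN — the exponent class `(1,5,42)` by its CM type.** `CM48Datum` is satisfied by three exponent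
classes `y⁴⁸ = x(x−1)^a`, `a ∈ {5, 17, 41}`; their CM types restricted to the primitive characters
`(ℤ/48)^×` (the part `B₁ = im f`) are `Φ₅ = {1,5,7,11,13,23,29,31}`, `Φ₁₇ = {1,5,7,13,17,23,29,37}`,
`Φ₄₁ = {1,5,11,13,17,19,25,41}` (Chevalley–Weil, `d_j = −1 + Σ_i ⟨−m_i j/48⟩`), pairwise inequivalent under
`(ℤ/48)^×`; `Φ₅` is PRIMITIVE (trivial stabiliser: `B₁` simple), `Φ₁₇`, `Φ₄₁` are NOT (stabilisers `{1,17}`,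
`{1,41}`: `B₁` isogenous to a square) and for `a ∈ {17,41}` the genus-3 quotient `C/⟨σ⁸⟩ ≅ {w² = 4v⁸+1}` is
HYPERELLIPTIC with Schoen's four branch points in two conjugate pairs (so `P₀ = (g¹₂)^{(4)}` is composed with the
pencil — a degenerate configuration outside Schoen's general-position analysis). This predicate pins `a = 5`:
the `H^{1,0}`-multiplicities of `s = σ_*` on the primitive 48-th roots of unity are those of `Φ₅` up to a unit
`u` (the unit absorbs the choice of primitive root, pull-back vs push-forward and `H^{1,0}` vs `H^{0,1}`).
[cite: Schoen1988HodgeWeil, §3 (the CM point)] [cite: MoonenZarhin1998WeilClasses, §1 (n_σ)] -/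
def CMTypeIsPhi5 {C : SchemeOver ℂ} (𝒥 : Jacobian C) (s : 𝒥.J ⟶ 𝒥.J) : Prop :=
  ∃ u : ℕ, Nat.Coprime u 48 ∧ ∀ j : ℕ, j < 48 → Nat.Coprime j 48 →
    eigenMultiplicity 𝒥.J s (Complex.exp (2 * Real.pi * Complex.I * ((u * j : ℕ) : ℂ) / 48)) =
      if j ∈ ({1, 5, 7, 11, 13, 23, 29, 31} : Finset ℕ) then 1 else 0

/-- An **ordered `n`-th power** `C^n = C ×_ℂ ⋯ ×_ℂ C` of a `ℂ`-scheme, as DATA: an object with `n` projections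
forming a limit fan in `SchemeOver ℂ` (products over `Spec ℂ` exist; any two presentations are uniquely
isomorphic). Used instead of the symmetric power `C^{(n)}`: the Abel–Prym image of an `S_n`-stable locus is the
same. [cite: Milne1986JacobianVarieties, §3, §5 (the powers C^r, symmetric powers C^{(r)} and the maps f^{(r)} : C^{(r)} → J)] -/
structure OrdPow (C : SchemeOver ℂ) (n : ℕ) where
  /-- the product object -/
  P : SchemeOver ℂ
  /-- the projections -/
  proj : Fin n → (P ⟶ C)
  /-- it is a product -/
  isLimit : IsLimit (Fan.mk (f := fun _ : Fin n => C) P proj)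

/-- The **Abel sum map** `C^n → A`, `(x₁,…,x_n) ↦ a(x₁) + ⋯ + a(x_n)` for a morphism `a : C → A` to an abelian
variety (product in the commutative group `Hom(C^n, A)`, Mathlib `Hom.commGroup`). With `a = f^P` the Abel–Jacobi
map this is `Λ ∘ (C^n → C^{(n)})`. [cite: Milne1986JacobianVarieties, §5 (the maps f^{(r)} : C^{(r)} → J)] -/
def OrdPow.sumMap {C : SchemeOver ℂ} {n : ℕ} (T : OrdPow C n) {A : AbelianVariety ℂ} (a : C ⟶ A.X) :
    T.P ⟶ A.X :=
  ∏ i : Fin n, (T.proj i ≫ a)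

/-- **«Curve-built» (norm-built) cycles on the primitive Prym `B = im f`** of a CM-48 datum: `Z ⊂ B` (via `κ`) is
the CLOSURE OF THE ABEL–PRYM IMAGE `u(W)`, `u = (f^P)^{(8)} ≫ (J ↠ im f)`, of an IRREDUCIBLE subset `W ⊂ C⁸`
all of whose points have NORM DIVISOR IN ONE COMPLETE LINEAR SYSTEM of the quotient curve `Y = C/⟨σ⁸⟩` (genus 3):
`Nm_J ∘ Λ` is constant on `W`, `Nm_J = (π_C)_* : J(C) → J(Y)`. Schoen's `Q_c ⊂ Nm⁻¹(P₀) ⊂ Nm⁻¹(P_∞)`,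
`P_∞ = |K_Y + b₁+b₂+b₃+b₄|`, are such `W` (ordered version), with `F_c = u(Q_c)`. NOT captured (no carrier for
sections/residues): that `Nm(W)` is Schoen's HYPERPLANE `P₀ = |ω_{Y₀}|` of `P_∞` — so the statements below cover
every curve-built fourfold with a Weil component, of which the `F_c` are the only known instances. PREDICATE.
[cite: Schoen1988HodgeWeil, §2 (construction), L. 2.4–2.5, Thm 2.0] -/
def IsNormBuilt (C : SchemeOver ℂ) (𝒥 : Jacobian C) (σ : C ⟶ C) (f : 𝒥.J ⟶ 𝒥.J)
    (Z : Scheme.{0}) (κ : Z ⟶ (AbelianVariety.image f).X.left) : Prop :=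
  ∃ (Y : SchemeOver ℂ) (𝒥Y : Jacobian Y) (πC : C ⟶ Y) (P : ComplexPoints C) (T : OrdPow C 8)
    (W : Set ↥T.P.left) (m : ↥𝒥Y.J.X.left),
    IsSmoothProjective 1 Y ∧ 𝒥Y.J.dim = 3 ∧ (End.of σ ^ 8).asHom ≫ πC = πC ∧
    Function.Surjective πC.left.base ∧
    (∀ x x' : ComplexPoints C, x ≫ πC = x' ≫ πC ↔ ∃ k : ℕ, x' = x ≫ (End.of σ ^ (8 * k)).asHom) ∧
    IsIrreducible W ∧
    W ⊆ (T.sumMap (𝒥.abelJacobi P) ≫ (𝒥.pushforward 𝒥Y πC).hom.hom.hom).left.base ⁻¹' {m} ∧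
    Set.range κ.base =
      closure ((T.sumMap (𝒥.abelJacobi P) ≫ (AbelianVariety.toImage f).hom.hom.hom).left.base '' W)

/-- **A Schoen cycle at the CM member** for the frame `(C, 𝒥, σ, f; ψ₀, e, a)`: a closed INTEGRAL `Z ⊂ B₁ = im f`
of codimension EXACTLY 4 (every point of the image of codimension `≥ 4` — the binder of `HasBlochSeedAt`, referee
n8 — and some point of codimension `4`), CURVE-BUILT (`IsNormBuilt`), whose class line carries `q·h_K⁴ + w` for a
NON-ZERO rational Weil class `w ∈ W_K` (`weilClassesOf B ψ₀ 4 3`) — Schoen's `δ_c[F_c] = q_c θ′⁴ + w_c`,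
`w_c ≠ 0`. PREDICATE (true of the six `F_c`). [cite: Schoen1988HodgeWeil, Thm 2.0, (2.6)] -/
def SchoenCycleAt (C : SchemeOver ℂ) (𝒥 : Jacobian C) (σ : C ⟶ C) (f : 𝒥.J ⟶ 𝒥.J)
    (ψ₀ : AbelianVariety.image f ⟶ AbelianVariety.image f) (e : ProjectiveEmbedding (AbelianVariety.image f).X)
    (a : complexBetti (projectiveSpace e.n ℂ) 2)
    (Z : Scheme.{0}) (κ : Z ⟶ (AbelianVariety.image f).X.left) : Prop :=
  IsClosedImmersion κ ∧ AlgebraicGeometry.IsIntegral Z ∧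
  (∀ z ∈ Set.range κ.base, (4 : ℕ∞) ≤ Order.coheight z) ∧ (∃ z : Z, Order.coheight (κ.base z) = (4 : ℕ∞)) ∧
  IsNormBuilt C 𝒥 σ f Z κ ∧
  ∃ (q : ℚ) (w : complexBetti (AbelianVariety.image f).X (2 * 4)),
    w ∈ weilClassesOf (AbelianVariety.image f) ψ₀ 4 3 ∧ IsRationalClass w ∧ w ≠ 0 ∧
    ((q : ℚ) : ℂ) • cupPowTwo (hK ψ₀ e a) 4 + w ∈
      classesSupportedOn (AbelianVariety.image f).X (Set.range κ.base) (2 * 4)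

end SchoenFrame

end Literature.AlgebraicGeometry.HodgeTheory

end
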